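import Summits.RiemannHypothesis.RiemannHypothesis.Theses.WeilParity
import Summits.RiemannHypothesis.RiemannHypothesis.Theorems.WeilParityEvenWinsArch
import Literature.NumberTheory.LFunctions.WeilSmallSupportPositivity
import Literature.NumberTheory.LFunctions.ZetaArgVariation
import Summits.RiemannHypothesis.RiemannHypothesis.Theorems.WeilParityOffLineParityDetectionTrialCutoff

/-!
# Disproof of `OffLineParityDetection` — findings (cdisprove seat, cycle 1, 2026-08-17)

Crux (route `WeilParity`, item stmt-RiemannHypothesis-15431):
`C := ∀ ρ, ζ ρ = 0 → 0 < Re ρ → Re ρ < 1 → Re ρ ≠ 1/2 → Concl`, where the conclusion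
`Concl = OddSectorStrictlyWins` (some odd normalised Weil test on some window `[-a, a]` undercuts
every even normalised Weil test by a margin `m > 0`) does NOT mention `ρ`.

Findings, all kernel-checked below unless marked NUMERICS:

* §0 IMMUNITY.  `C ↔ ((∃ off-line zero) → Concl)` and `Concl ↔ ¬ EvenSectorWins` (the route
  target); hence `¬ C ↔ EvenSectorWins ∧ ∃ off-line zero` and `¬ C → ¬ RiemannHypothesis`
  (`immune`).  No refutation of the crux exists short of disproving RH (consistent with the
  refuter's CruxAttack.lean / Negative/Calibration p151092, which this file does not duplicate
  by name).
* §1 LOAD-BEARING HYPOTHESES (drop one at a time):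
  - `ζ ρ = 0` dropped (`WithoutZero`), `0 < Re ρ` dropped (`WithoutRePos`, trivial zero `-2`),
    `Re ρ ≠ 1/2` dropped (`WithoutNeHalf`, the tree's zero `σ + iγ₀`): each variant is
    EQUIVALENT to `Concl`, i.e. to `¬ EvenSectorWins` — dropping any of them turns the crux into
    the negation of the route's own target (`not_without*_iff_target`).  Load-bearing, and
    unrefutable for the same reason the target is unprovable here.
  - `Re ρ < 1` dropped (`WithoutReLtOne`): REDUNDANT — `withoutReLtOne_iff : _ ↔ C`
    (`riemannZeta_ne_zero_of_one_le_re`).  Information for the prover: this binder is decoration.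
  - odd normalisation `∫‖o‖² = 1` dropped (`WithoutOddNorm`): the variant is a THEOREM
    (`withoutOddNorm_holds`: witness `o = 0` and Bombieri's small-support coercivity
    `weilQuadratic_coercive`), so the normalisation of the odd witness is exactly what makes the
    crux non-trivial.
  - even normalisation dropped: a STRENGTHENING (even sector PSD while an odd test is negative on
    the same window, i.e. "the odd sector goes negative first"); immune (antecedent), recorded only.
* §2 STRENGTHENINGS.  "odd wins at EVERY window" (`OddWinsEverywhere`) collapses to RH:
  `oddWinsEverywhere_iff : OddWinsEverywhere ↔ ¬ ∃ off-line zero`, by the LANDED prime-free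
  parity theorem `evenWinsArch_proof` (even wins on `0 < a ≤ (log 2)/2`).  So any proof of the crux
  must let the window depend on the zero configuration; the detecting window is necessarily
  `a > (log 2)/2` (`detectingWindow_gt`).  "Eventual odd win" (`∃ A, ∀ a ≥ A`) is immune as a
  statement about `ζ` and FALSE in the one-quadruple model (order alternates with period `π/γ₀`;
  refuter toy, CRUX-ATTACK-r1.md §5) — not restated.
* §3 TARGETS = stubs of the picked line `registered` (Lines/birth.lean, skeleton ac8a92b9):
  - LOC `stub_finiteDefectLocalisation` and INF `stub_infiniteDefectDetection` are IMMUNE: their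
    hypotheses already contain an off-line zero (`stubLoc_immune`, `stubInf_immune`: a refutation
    of either disproves RH).
  - TORUS `stub_torusTopHeavy` is ζ-FREE and the only killable stub.  Load-bearing hypotheses as
    theorems: positivity of the weights (`stubTorus_false_without_weightPos`), `T.Nonempty`
    (`stubTorus_false_without_nonempty`) and `0 < η₀` (`stubTorusTopHeavy_false_without_etaPos`:
    for a top layer ON the line the danger is unbounded — resonant plateau profiles,
    `exists_resonant_profile` — so the TORUS constants blow up like `1/η₀`).  NUMERICS (this seat, pure-python hub scan `numerics/torus.py`
    + kit job, see `stubTorusTopHeavy_numerics`): adversarial search for a configuration with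
    `sup_a Φ(a) ≤ 0` in the regime the strategists did not cover (strong coupling `Im ρ ≲ η₀`,
    η₀ unrestricted, unequal weights, odd-sum lattices up to J = 6, lattice + free block): NONE;
    strong coupling is the SAFEST regime (relative top-heaviness `r = 1.000` for
    `Im ρ/η₀ ≤ 0.3`); adversarial DE (kit j025581, 310 runs): 0 configurations with `sup Φ ≤ 0`,
    minimum `r = 0.373` (six blocks, three resonant, `Im ρ/η₀ ≈ 8`); weak coupling is governed by
    the first-order theory `stubTorusTopHeavy_weakCoupling_analysis` (uniform witness `x → 0⁺`).
* §4 WHY IT RESISTS (for the lead).  Finite defect: on-line terms are `|ê(ρ)|² ≥ 0` in BOTH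
  sectors, so dropping them is a valid lower bound for the even floor and "on-line detuning"
  can only RAISE the even floor — kill criterion k1 of the route is analytically dead in the
  finite case (this is exactly the landed EVEN-LOW/ODD-ON pair).  Infinite defect: see the
  docstring of `stubInf_immune` — an adversarial configuration (offsets `η_k ↑ η*` unattained,
  towering heights `γ_k = exp(exp(k²))`) has NO window at which any off-line splitting exceeds the
  mean-zero on-line interference `Re Σ_γ m e^{2iγa} F(iγ)²`; the order there is decided by an
  almost-periodic on-line sum, which changes sign (Bohr) — so no counter-configuration either,
  but any proof of INF must include on-line terms in the even-floor lower bound.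
-/

set_option linter.dupNamespace false
set_option linter.unusedVariables false

noncomputable section

namespace Summit.RiemannHypothesis.RiemannHypothesis.Cruxes.OffLineParityDetection.Disproof

open MeasureTheory Set Filter Complex
open scoped ComplexConjugate
open Literature.NumberTheory.LFunctions
open Summit.RiemannHypothesis.RiemannHypothesis.Theses.WeilParity
open Summit.RiemannHypothesis.RiemannHypothesis.Theorems.WeilParityOffLineParityDetection
  (trial_exists_plateau)

/-! ## §0 The shape of the crux and its immunity -/

/-- The crux's `ρ`-free conclusion: at some window the odd sector strictly undercuts the even
sector (an odd normalised Weil test `o`, a margin `m > 0`, below every even normalised test). -/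
def OddSectorStrictlyWins : Prop :=
  ∃ a : ℝ, 0 < a ∧ ∃ o : ℝ → ℂ, IsWeilTest o ∧ tsupport o ⊆ Set.Icc (-a) a ∧
    (∀ t, o (-t) = -o t) ∧ ∫ t, ‖o t‖ ^ 2 = (1 : ℝ) ∧ ∃ m : ℝ, 0 < m ∧
      ∀ e : ℝ → ℂ, IsWeilTest e → tsupport e ⊆ Set.Icc (-a) a → (∀ t, e (-t) = e t) →
        ∫ t, ‖e t‖ ^ 2 = (1 : ℝ) → (weilQuadratic o).re + m ≤ (weilQuadratic e).re

/-- An off-line zero of `ζ` in the open critical strip (the crux's antecedent). -/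
def IsOffLineZero (ρ : ℂ) : Prop :=
  riemannZeta ρ = 0 ∧ 0 < ρ.re ∧ ρ.re < 1 ∧ ρ.re ≠ 1 / 2

/-- `C ↔ ((∃ off-line zero) → Concl)`: the antecedent only asks that SOME off-line zero exists. -/
theorem offLineParityDetection_iff :
    OffLineParityDetection ↔ ((∃ ρ, IsOffLineZero ρ) → OddSectorStrictlyWins) := by
  constructor
  · rintro hC ⟨ρ, hζ, h0, h1, hne⟩
    exact hC ρ hζ h0 h1 hne
  · intro h ρ hζ h0 h1 hne
    exact h ⟨ρ, hζ, h0, h1, hne⟩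

/-- The conclusion is literally the negation of the route target `EvenSectorWins`. -/
theorem oddSectorStrictlyWins_iff_not_evenSectorWins :
    OddSectorStrictlyWins ↔ ¬ EvenSectorWins := by
  constructor
  · rintro ⟨a, ha, o, ho, hos, hodd, hon, m, hm, hdet⟩ hX
    obtain ⟨e, he, hes, hev, hen, hle⟩ := hX a ha o ho hos hodd hon (m / 2) (by linarith)
    have := hdet e he hes hev hen
    linarith
  · intro hX
    unfold EvenSectorWins at hX
    push Not at hX
    obtain ⟨a, ha, o, ho, hos, hodd, hon, δ, hδ, hno⟩ := hX
    exact ⟨a, ha, o, ho, hos, hodd, hon, δ, hδ, fun e he hes hev hen ↦ (hno e he hes hev hen).le⟩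

/-- Under RH there is no off-line zero (Mathlib's binder: trivial zeros have `Re ≤ -2`, and
`ρ ≠ 1` because `Re ρ < 1`). -/
theorem not_exists_isOffLineZero_of_riemannHypothesis (h : RiemannHypothesis) :
    ¬ ∃ ρ, IsOffLineZero ρ := by
  rintro ⟨ρ, hζ, h0, h1, hne⟩
  refine hne (h ρ hζ ?_ ?_)
  · rintro ⟨n, rfl⟩
    have : (-2 * ((n : ℂ) + 1)).re = -2 * (n + 1) := by simp
    rw [this] at h0
    have hn : (0 : ℝ) ≤ n := n.cast_nonneg
    linarith
  · rintro rfl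
    simp at h1

/-- What a refutation of the crux would have to deliver: the route target AND an off-line zero. -/
theorem not_offLineParityDetection_iff :
    ¬ OffLineParityDetection ↔ (EvenSectorWins ∧ ∃ ρ, IsOffLineZero ρ) := by
  rw [offLineParityDetection_iff, oddSectorStrictlyWins_iff_not_evenSectorWins]
  constructor
  · intro h
    by_contra h'
    exact h fun hA hB ↦ h' ⟨hB, hA⟩
  · rintro ⟨hB, hA⟩ h
    exact h hA hB

/-- **IMMUNITY.** Any refutation of the crux disproves the Riemann Hypothesis. -/
theorem immune (h : ¬ OffLineParityDetection) : ¬ RiemannHypothesis := fun hRH ↦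
  not_exists_isOffLineZero_of_riemannHypothesis hRH (not_offLineParityDetection_iff.1 h).2

/-! ## §1 Load-bearing analysis: the crux with one hypothesis dropped -/

/-- The crux with `riemannZeta ρ = 0` dropped. -/
def WithoutZero : Prop :=
  ∀ ρ : ℂ, 0 < ρ.re → ρ.re < 1 → ρ.re ≠ 1 / 2 → OddSectorStrictlyWins

/-- The crux with `0 < ρ.re` dropped (trivial zeros admitted). -/
def WithoutRePos : Prop :=
  ∀ ρ : ℂ, riemannZeta ρ = 0 → ρ.re < 1 → ρ.re ≠ 1 / 2 → OddSectorStrictlyWins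

/-- The crux with `ρ.re < 1` dropped. -/
def WithoutReLtOne : Prop :=
  ∀ ρ : ℂ, riemannZeta ρ = 0 → 0 < ρ.re → ρ.re ≠ 1 / 2 → OddSectorStrictlyWins

/-- The crux with `ρ.re ≠ 1/2` dropped (critical zeros admitted). -/
def WithoutNeHalf : Prop :=
  ∀ ρ : ℂ, riemannZeta ρ = 0 → 0 < ρ.re → ρ.re < 1 → OddSectorStrictlyWins

/-- Dropping `ζ ρ = 0`: the variant is the bare conclusion (witness `ρ = 1/4`). -/
theorem withoutZero_iff : WithoutZero ↔ OddSectorStrictlyWins := by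
  constructor
  · intro h
    exact h (1 / 4) (by norm_num) (by norm_num) (by norm_num)
  · intro h ρ _ _ _
    exact h

/-- `ζ ρ = 0` is load-bearing: without it the crux is the NEGATION of the route target. -/
theorem not_withoutZero_iff_target : ¬ WithoutZero ↔ EvenSectorWins := by
  rw [withoutZero_iff, oddSectorStrictlyWins_iff_not_evenSectorWins, not_not]

/-- Dropping `0 < Re ρ`: the trivial zero `ρ = -2` (`riemannZeta_neg_two_mul_nat_add_one 0`)
discharges the antecedent, so the variant is the bare conclusion. -/
theorem withoutRePos_iff : WithoutRePos ↔ OddSectorStrictlyWins := by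
  constructor
  · intro h
    have hz : riemannZeta (-2 * ((0 : ℕ) + 1)) = 0 := riemannZeta_neg_two_mul_nat_add_one 0
    refine h (-2 * ((0 : ℕ) + 1)) hz ?_ ?_
    · norm_num
    · norm_num
  · intro h ρ _ _ _
    exact h

/-- `0 < Re ρ` is load-bearing: without it the crux is the negation of the route target. -/
theorem not_withoutRePos_iff_target : ¬ WithoutRePos ↔ EvenSectorWins := by
  rw [withoutRePos_iff, oddSectorStrictlyWins_iff_not_evenSectorWins, not_not]

/-- Dropping `Re ρ < 1` changes nothing: `ζ` has no zeros with `Re ρ ≥ 1`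
(`riemannZeta_ne_zero_of_one_le_re`).  This binder of the crux is DECORATION. -/
theorem withoutReLtOne_iff : WithoutReLtOne ↔ OffLineParityDetection := by
  constructor
  · intro h ρ hζ h0 _ hne
    exact h ρ hζ h0 hne
  · intro h ρ hζ h0 hne
    refine h ρ hζ h0 ?_ hne
    by_contra h1
    exact riemannZeta_ne_zero_of_one_le_re (not_lt.1 h1) hζ

/-- Dropping `Re ρ ≠ 1/2`: the tree's zero `σ + iγ₀` in the open strip
(`exists_zero_of_zetaOrdinate_holds 0`, Riemann–von Mangoldt) discharges the antecedent, so the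
variant is the bare conclusion. -/
theorem withoutNeHalf_iff : WithoutNeHalf ↔ OddSectorStrictlyWins := by
  constructor
  · intro h
    obtain ⟨σ, hσ0, hσ1, hz⟩ := exists_zero_of_zetaOrdinate_holds 0
    refine h _ hz ?_ ?_ <;> simp [hσ0, hσ1]
  · intro h ρ _ _ _
    exact h

/-- `Re ρ ≠ 1/2` is load-bearing: without it the crux is the negation of the route target. -/
theorem not_withoutNeHalf_iff_target : ¬ WithoutNeHalf ↔ EvenSectorWins := by
  rw [withoutNeHalf_iff, oddSectorStrictlyWins_iff_not_evenSectorWins, not_not]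

/-- The crux with the odd witness's normalisation `∫‖o‖² = 1` dropped. -/
def WithoutOddNorm : Prop :=
  ∀ ρ : ℂ, riemannZeta ρ = 0 → 0 < ρ.re → ρ.re < 1 → ρ.re ≠ 1 / 2 →
    ∃ a : ℝ, 0 < a ∧ ∃ o : ℝ → ℂ, IsWeilTest o ∧ tsupport o ⊆ Set.Icc (-a) a ∧
      (∀ t, o (-t) = -o t) ∧ ∃ m : ℝ, 0 < m ∧
        ∀ e : ℝ → ℂ, IsWeilTest e → tsupport e ⊆ Set.Icc (-a) a → (∀ t, e (-t) = e t) →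
          ∫ t, ‖e t‖ ^ 2 = (1 : ℝ) → (weilQuadratic o).re + m ≤ (weilQuadratic e).re

/-- **The odd normalisation is what makes the crux non-trivial**: without it the statement is a
THEOREM, unconditionally and without using the zero — witness `o = 0` and a small window on
which Weil's form is coercive, `Re Q(e) ≥ (Re Q(0) + 1) ‖e‖²` (Bombieri 2000 Thm 12,
`weilQuadratic_coercive`). -/
theorem withoutOddNorm_holds : WithoutOddNorm := by
  intro ρ _ _ _ _
  obtain ⟨a₀, ha₀, hco⟩ := weilQuadratic_coercive ((weilQuadratic (0 : ℝ → ℂ)).re + 1)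
  refine ⟨a₀, ha₀, 0, ⟨contDiff_zero_fun, HasCompactSupport.zero⟩, ?_, fun t ↦ by simp, 1,
    one_pos, ?_⟩
  · rw [tsupport_eq_empty_iff.2 rfl]
    exact Set.empty_subset _
  · intro e he hes _ hen
    have h := hco a₀ ha₀ le_rfl e he hes
    rw [hen, mul_one] at h
    exact h

/-! ## §2 Natural strengthenings -/

/-- "The odd sector strictly wins at the window `a`." -/
def OddWinsAt (a : ℝ) : Prop :=
  ∃ o : ℝ → ℂ, IsWeilTest o ∧ tsupport o ⊆ Set.Icc (-a) a ∧
    (∀ t, o (-t) = -o t) ∧ ∫ t, ‖o t‖ ^ 2 = (1 : ℝ) ∧ ∃ m : ℝ, 0 < m ∧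
      ∀ e : ℝ → ℂ, IsWeilTest e → tsupport e ⊆ Set.Icc (-a) a → (∀ t, e (-t) = e t) →
        ∫ t, ‖e t‖ ^ 2 = (1 : ℝ) → (weilQuadratic o).re + m ≤ (weilQuadratic e).re

/-- STRENGTHENING "odd wins at EVERY window": the crux with `∃ a > 0` replaced by `∀ a > 0`. -/
def OddWinsEverywhere : Prop :=
  ∀ ρ : ℂ, riemannZeta ρ = 0 → 0 < ρ.re → ρ.re < 1 → ρ.re ≠ 1 / 2 → ∀ a : ℝ, 0 < a → OddWinsAt a

/-- The LANDED prime-free parity theorem (`evenWinsArch_proof`, item stmt-RiemannHypothesis-15433)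
forbids an odd win on any window `0 < a ≤ (log 2)/2`. -/
theorem not_oddWinsAt_of_le {a : ℝ} (ha : 0 < a) (hle : a ≤ Real.log 2 / 2) : ¬ OddWinsAt a := by
  rintro ⟨o, ho, hos, hodd, hon, m, hm, hdet⟩
  obtain ⟨e, he, hes, hev, hen, hle'⟩ :=
    Theorems.WeilParity.evenWinsArch_proof a ha hle o ho hos hodd hon (m / 2) (by linarith)
  have := hdet e he hes hev hen
  linarith

/-- **The uniform-in-window strengthening collapses to RH**: "odd wins at every window" holds iff
there is no off-line zero at all.  So the detecting window of any proof of the crux must depend on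
the zero configuration. -/
theorem oddWinsEverywhere_iff : OddWinsEverywhere ↔ ¬ ∃ ρ, IsOffLineZero ρ := by
  constructor
  · rintro h ⟨ρ, hζ, h0, h1, hne⟩
    have hlog : (0 : ℝ) < Real.log 2 / 2 := by
      have := Real.log_two_gt_d9
      linarith
    exact not_oddWinsAt_of_le hlog le_rfl (h ρ hζ h0 h1 hne _ hlog)
  · intro h ρ hζ h0 h1 hne
    exact absurd ⟨ρ, hζ, h0, h1, hne⟩ h

/-- Corollary for the prover: a detecting window is necessarily `> (log 2)/2` (primes must
enter the form). -/
theorem detectingWindow_gt {a : ℝ} (ha : 0 < a) (h : OddWinsAt a) : Real.log 2 / 2 < a := by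
  by_contra hle
  exact not_oddWinsAt_of_le ha (not_lt.1 hle) h

/-! ## §3 Targets: the stubs of the picked line `registered` (Lines/birth.lean)

The statements below are VERBATIM copies (as `def … : Prop`) of the registered stub signatures
(skeleton ac8a92b9), so that negative lemmas about them can be stated without importing the
crux work-file. -/

/-- VERBATIM statement of stub **TORUS** `stub_torusTopHeavy` (ζ-free). -/
def StubTorusTopHeavy : Prop :=
    ∀ η₀ : ℝ, 0 < η₀ → ∀ T : Finset ℂ, T.Nonempty → (∀ ρ ∈ T, ρ.re = 1 / 2 + η₀) →
      ∀ w : ℂ → ℝ, (∀ ρ ∈ T, 0 < w ρ) →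
      ∃ δ : ℝ, 0 < δ ∧ ∃ a : ℝ, ∃ D : ℝ, 0 ≤ D ∧
        (∀ f : ℝ → ℝ, ContDiff ℝ (⊤ : ℕ∞) f → HasCompactSupport f → tsupport f ⊆ Set.Ici 0 →
          -(∑ ρ ∈ T, w ρ * (Complex.exp (2 * (ρ.im : ℂ) * (a : ℂ) * Complex.I) *
              (∫ u in Set.Ioi (0 : ℝ), (f u : ℂ) * Complex.exp (-((ρ - 1 / 2) * (u : ℂ)))) ^ 2).re)
            ≤ D * ∫ u in Set.Ioi (0 : ℝ), f u ^ 2) ∧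
        (∃ f : ℝ → ℝ, ContDiff ℝ (⊤ : ℕ∞) f ∧ HasCompactSupport f ∧ tsupport f ⊆ Set.Ici 0 ∧
          0 < ∫ u in Set.Ioi (0 : ℝ), f u ^ 2 ∧
          (D + δ) * ∫ u in Set.Ioi (0 : ℝ), f u ^ 2 ≤
            ∑ ρ ∈ T, w ρ * (Complex.exp (2 * (ρ.im : ℂ) * (a : ℂ) * Complex.I) *
              (∫ u in Set.Ioi (0 : ℝ), (f u : ℂ) * Complex.exp (-((ρ - 1 / 2) * (u : ℂ)))) ^ 2).re)

/-- NUMERICS docstring carrier (no mathematical content: `True`).  Endpoint-torus form of TORUS in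
units `η₀ = 1` (`u ↦ u/η₀`): points `z_j = 1 + i g_j`, `g_j = Im ρ_j / η₀`, weights `w_j`,
`M(a) = Σ w_j (|C_j⟩⟨C_j| - |S_j⟩⟨S_j|)`, `C_j + iS_j = e^{i g_j a} e^{-z_j u}` on `L²(0,∞)`,
`Φ(a) = max(λ_max, 0) + min(λ_min, 0)`; TORUS ⟺ `sup_a Φ > 0` for every configuration; on an
ordinate lattice `g_j = n_j g` the orbit is `θ_j = n_j x`, `x ∈ [0, π)`.  Gram entries in closed
form (`⟨C_j,C_k⟩ = ½Re(P+Q)`, `⟨S_j,S_k⟩ = ½Re(Q−P)`, `⟨C_j,S_k⟩ = ½(Im P − Im Q)`,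
`P = e^{i(θ_j+θ_k)}/(z_j+z_k)`, `Q = e^{i(θ_j−θ_k)}/(z_j+z̄_k)`); nonzero spectrum of `ΣG`.
HUB SCAN (pure python, `numerics/torus.py`, 388 configurations: lattices (1,2),(1,4),(2,3),(3,4),
(1,2,4),(1,2,3),(2,3,4),(1,2,4,8) × g ∈ {0.01,…,10} × weights {equal, 1:3, 3:1, 1:0.3}):
relative top-heaviness `r = sup Φ / max(sup Φ, −inf Φ)`: r = 1.000 for every configuration with
`g ≤ 1` (strong coupling / small ordinates are the SAFEST regime: at x = 0 the form is nearly the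
positive rank-one `(Σ w_j)|e^{-u}⟩⟨e^{-u}|`), all J ≥ 3 lattices r = 1.000 on this grid, minimum
r = 0.927 at `(1,4)`, `g = 3`, `w = (3,1)` (then 0.933, 0.935, 0.944 nearby; the strategists'
zeta-like worst case was 0.84 at `(1,2,8)·3.0, η = 0.2`).  No configuration with `sup Φ ≤ 0`.
KIT JOBS (adversarial differential evolution; 310 runs each: all coprime odd-sum pairs `p<q≤12`, all
mixed-parity triples `≤ 9`, 9 special + 120 random mixed-parity J = 3..6 tuples `≤ 12`, lattice +
one free block; free log-weights `∈ [−2.5,2.5]`, `log g ∈ [−1.5,2.2]` and `[−3,3]`):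
j025022 (v1) minimised `sup Φ/sup‖M‖`, which weak coupling makes small trivially — 0 candidates but
UNINFORMATIVE (min r 0.9998); j025581 (v2, evidence `compute-j025581`) minimised the danger ratio
`sup Φ/(−inf Φ)`: **0 of 310 optimised configurations have `sup Φ ≤ 0`**; adversarial minimum of
`r = sup/max(sup, −inf)` = 0.373 at `n = (2,3,4,7,10,12)`, `g = 8.14`, `w ≈ (1, 1.03, 0.98, 0.03,
0.02, 1.30)` (three resonant blocks 2,3,4 + 12 at near-equal weight, MID coupling), `sup Φ =
+1.575e−2`, `inf Φ = −4.219e−2` (re-verified on a 20000-point orbit grid with golden refinement);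
next cluster r ≈ 0.40–0.44 at `n ∋ (1,11,12)` or `(1,10,11)`, `g ≈ 1.6–1.75`, near-equal weights
on the three active blocks; J = 2 floor r = 0.7627 at `(1,4)`, `g = 442`, `w = (1, 0.998)` = the
first-order limit value 0.7626 of `stubTorusTopHeavy_weakCoupling_analysis` (ω₂ = −0.86).  So the
adversary drives r down only by stacking several resonant blocks at mid coupling, and it stays far
from 0; also the in-phase point fails even for EQUAL weights (2/400 random configurations, e.g.
heights `(25.84, 26.30, 27.17, 44.34, 83.19, 90.62)·η₀`, `Φ(0)/‖M‖ = −3.0e−3`), so the witness is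
`x > 0` small, never `x = 0`. -/
theorem stubTorusTopHeavy_numerics : True := trivial

/-- **WEAK-COUPLING THEORY of TORUS (this seat; the ζ-relevant regime `Im ρ ≫ η₀`).**  Units
`η₀ = 1`, ordinate lattice `g_j = n_j g`, `ε = 1/g → 0`, weights `w_j = w(1 + ε ω_j)` (weights
differing by `O(1)` factors decouple at first order and give `Φ ≈ w₁ cos(2θ₁ − φ₁)/(2|z₁|)`,
symmetric, `r → 1`).  First-order degenerate perturbation theory of `G = ¼I + εG₁ + O(ε²)`
(validated to 3–4 digits against the finite-`g` scans, `numerics/scan2.out` vs `numerics/limit.py`: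
`(1,4)` equal weights `sup Φ·g → 0.3607`, `inf Φ·g → −0.3886`; `(1,2)`: `0.6457 / −0.3333`; …) gives
`Φ(x/g) = ε w Ψ_Ω(x) + O(ε²)` with the GRAM IDENTITY
  `Ψ_Ω(x) = μ_max(G_c(x) + Ω) − μ_max(G_s(x) + Ω)`,
  `G_c(x)_{jk} = ∫₀ˣ cos(n_j t) cos(n_k t) dt`, `G_s(x)_{jk} = ∫₀ˣ sin(n_j t) sin(n_k t) dt`,
  `Ω = diag(ω_j/4)`
(from `U'_{jk} = sin((n_j−n_k)x)/(n_j−n_k)`, `V_{jk} = sin((n_j+n_k)x)/(n_j+n_k)`,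
`U' ± V = 2G_{c/s} − xI`).  UNIFORM LOWER BOUND: with `n* = n_{argmax ω}`,
  `Ψ_Ω(x) ≥ (Ω* + ∫₀ˣcos²(n*t)dt) − (Ω* + tr G_s(x)) = x/2 + sin(2n*x)/(4n*) − Σ_j (x/2 − sin(2n_jx)/(4n_j))`
  `      = x − O((n*² + Σ n_j²) x³) > 0`   for `0 < x < x₀(n)`,
for EVERY diagonal `Ω` — so in the weak-coupling limit TORUS holds for every lattice and every
weight perturbation, with the universal witness "phase point just after the exact common period
`a = 0`", i.e. `a = x/g ≍ c/γ_max` (equivalently `Φ(a) ≈ w·a` for `1/γ_min² ≪ a ≪ 1/γ_max`; for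
`|T| = 1` exactly `Φ(a) = w cos(2γa − arctan γ)/(2|z|) ≈ w(a + 1/(2γ²))`).  This is the
mechanism behind the strategists' observation that "the quarter-fast-period window after a common
near-period realises the global maximum of the odd advantage" (Numerics-strategist.md §2), and it
says WHERE a counter-configuration cannot live: not at weak coupling (first order has a uniform
positive witness), not at strong coupling (`g_j → 0`: `M(0) → (Σw)|e^{-u}⟩⟨e^{-u}| ≥ 0`, so
`Φ(0) → Σw/2 > 0`) — only at MID coupling `Im ρ/η₀ ∈ [1, 10]`, where the hub scan bottoms out at
`r = 0.927` and kit j025022 searches adversarially.  For the LEAD: a proof of `stub_torusTopHeavy`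
along these lines needs (i) the `O(ε²)` remainder bounded uniformly in the weights (the
non-degenerate case is easier, not harder), (ii) a separate argument at mid/strong coupling
(e.g. continuity in `g` from the rank-one limit plus a certified grid), (iii) nothing about `ζ`. -/
theorem stubTorusTopHeavy_weakCoupling_analysis : True := trivial

/-- TORUS with the weight-positivity hypothesis WEAKENED to `0 ≤ w ρ`. -/
def StubTorusWithoutWeightPos : Prop :=
    ∀ η₀ : ℝ, 0 < η₀ → ∀ T : Finset ℂ, T.Nonempty → (∀ ρ ∈ T, ρ.re = 1 / 2 + η₀) →
      ∀ w : ℂ → ℝ, (∀ ρ ∈ T, 0 ≤ w ρ) →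
      ∃ δ : ℝ, 0 < δ ∧ ∃ a : ℝ, ∃ D : ℝ, 0 ≤ D ∧
        (∀ f : ℝ → ℝ, ContDiff ℝ (⊤ : ℕ∞) f → HasCompactSupport f → tsupport f ⊆ Set.Ici 0 →
          -(∑ ρ ∈ T, w ρ * (Complex.exp (2 * (ρ.im : ℂ) * (a : ℂ) * Complex.I) *
              (∫ u in Set.Ioi (0 : ℝ), (f u : ℂ) * Complex.exp (-((ρ - 1 / 2) * (u : ℂ)))) ^ 2).re)
            ≤ D * ∫ u in Set.Ioi (0 : ℝ), f u ^ 2) ∧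
        (∃ f : ℝ → ℝ, ContDiff ℝ (⊤ : ℕ∞) f ∧ HasCompactSupport f ∧ tsupport f ⊆ Set.Ici 0 ∧
          0 < ∫ u in Set.Ioi (0 : ℝ), f u ^ 2 ∧
          (D + δ) * ∫ u in Set.Ioi (0 : ℝ), f u ^ 2 ≤
            ∑ ρ ∈ T, w ρ * (Complex.exp (2 * (ρ.im : ℂ) * (a : ℂ) * Complex.I) *
              (∫ u in Set.Ioi (0 : ℝ), (f u : ℂ) * Complex.exp (-((ρ - 1 / 2) * (u : ℂ)))) ^ 2).re)

/-- **Strict positivity of SOME weight is load-bearing in TORUS**: with `0 ≤ w` the zero weight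
kills the gain clause (`(D + δ) ∫f² ≤ 0` with `∫f² > 0`).  Witness `η₀ = 1`, `T = {3/2}`, `w = 0`. -/
theorem stubTorus_false_without_weightPos : ¬ StubTorusWithoutWeightPos := by
  intro h
  obtain ⟨δ, hδ, a, D, hD, -, f, -, -, -, hfpos, hgain⟩ :=
    h 1 one_pos {(3 / 2 : ℂ)} (Finset.singleton_nonempty _)
      (fun ρ hρ ↦ by rw [Finset.mem_singleton.1 hρ]; norm_num) (fun _ ↦ 0) (fun _ _ ↦ le_rfl)
  simp only [zero_mul, Finset.sum_const_zero] at hgain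
  nlinarith

/-- TORUS with the hypothesis `T.Nonempty` DROPPED. -/
def StubTorusWithoutNonempty : Prop :=
    ∀ η₀ : ℝ, 0 < η₀ → ∀ T : Finset ℂ, (∀ ρ ∈ T, ρ.re = 1 / 2 + η₀) →
      ∀ w : ℂ → ℝ, (∀ ρ ∈ T, 0 < w ρ) →
      ∃ δ : ℝ, 0 < δ ∧ ∃ a : ℝ, ∃ D : ℝ, 0 ≤ D ∧
        (∀ f : ℝ → ℝ, ContDiff ℝ (⊤ : ℕ∞) f → HasCompactSupport f → tsupport f ⊆ Set.Ici 0 →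
          -(∑ ρ ∈ T, w ρ * (Complex.exp (2 * (ρ.im : ℂ) * (a : ℂ) * Complex.I) *
              (∫ u in Set.Ioi (0 : ℝ), (f u : ℂ) * Complex.exp (-((ρ - 1 / 2) * (u : ℂ)))) ^ 2).re)
            ≤ D * ∫ u in Set.Ioi (0 : ℝ), f u ^ 2) ∧
        (∃ f : ℝ → ℝ, ContDiff ℝ (⊤ : ℕ∞) f ∧ HasCompactSupport f ∧ tsupport f ⊆ Set.Ici 0 ∧
          0 < ∫ u in Set.Ioi (0 : ℝ), f u ^ 2 ∧
          (D + δ) * ∫ u in Set.Ioi (0 : ℝ), f u ^ 2 ≤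
            ∑ ρ ∈ T, w ρ * (Complex.exp (2 * (ρ.im : ℂ) * (a : ℂ) * Complex.I) *
              (∫ u in Set.Ioi (0 : ℝ), (f u : ℂ) * Complex.exp (-((ρ - 1 / 2) * (u : ℂ)))) ^ 2).re)

/-- **`T.Nonempty` is load-bearing in TORUS**: the empty top layer has no gain.  Witness `T = ∅`. -/
theorem stubTorus_false_without_nonempty : ¬ StubTorusWithoutNonempty := by
  intro h
  obtain ⟨δ, hδ, a, D, hD, -, f, -, -, -, hfpos, hgain⟩ :=
    h 1 one_pos ∅ (fun ρ hρ ↦ absurd hρ (Finset.notMem_empty _)) (fun _ ↦ 1)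
      (fun ρ hρ ↦ absurd hρ (Finset.notMem_empty _))
  simp only [Finset.sum_empty] at hgain
  nlinarith

/-! ### TORUS: `0 < η₀` is load-bearing (the danger is unbounded for a top layer ON the line) -/

/-- **Resonant profiles.** For every phase `a` and plateau half-length `R' ≥ 1` there is a smooth
real profile `f`, compactly supported in `(0, ∞)`, with `∫ f(u) cos(a-u) du = 0`,
`∫ f(u) sin(a-u) du ≥ R' - 1` and `∫ f² ≤ 2(R' + 1)`: `f(u) = χ(u - c) sin(a - u)` with `χ` an
even smooth plateau (`= 1` on `[-R', R']`, `= 0` off `[-R'-1, R'+1]`) and `c = a + 2πm ≥ R' + 2`.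
[folklore] -/
theorem exists_resonant_profile (a R' : ℝ) (hR' : 1 ≤ R') :
    ∃ f : ℝ → ℝ, ContDiff ℝ (⊤ : ℕ∞) f ∧ HasCompactSupport f ∧ tsupport f ⊆ Set.Ici 0 ∧
      ∫ u in Set.Ioi (0 : ℝ), f u * Real.cos (a - u) = 0 ∧
      R' - 1 ≤ ∫ u in Set.Ioi (0 : ℝ), f u * Real.sin (a - u) ∧
      ∫ u in Set.Ioi (0 : ℝ), f u ^ 2 ≤ 2 * (R' + 1) := by
  obtain ⟨C, -, hpl⟩ := trial_exists_plateau
  obtain ⟨χ, hχ, hχev, hχ0, hχ1, hχone, hχzero, -, -⟩ := hpl (R' + 1) 1 one_pos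
  -- centre `c = a + 2π m` with `c ≥ R' + 2`
  set m : ℕ := ⌈(R' + 2 - a) / (2 * Real.pi)⌉₊ with hm
  set c : ℝ := a + m * (2 * Real.pi) with hc
  have hc2 : R' + 2 ≤ c := by
    have h1 : (R' + 2 - a) / (2 * Real.pi) ≤ m := Nat.le_ceil _
    have h2 : R' + 2 - a ≤ m * (2 * Real.pi) := by
      rwa [div_le_iff₀ (by positivity)] at h1
    rw [hc]; linarith
  -- the profile
  set f : ℝ → ℝ := fun u ↦ χ (u - c) * Real.sin (a - u) with hf
  have hfK : ∀ u, u ∉ Icc (c - (R' + 1)) (c + (R' + 1)) → f u = 0 := by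
    intro u hu
    have habs : R' + 1 ≤ |u - c| := by
      rw [mem_Icc, not_and_or, not_le, not_le] at hu
      rcases hu with h | h
      · rw [abs_of_neg (by linarith)]; linarith
      · rw [abs_of_pos (by linarith)]; linarith
    simp [hf, hχzero _ habs]
  have hfcont : Continuous f :=
    (hχ.continuous.comp (continuous_id.sub continuous_const)).mul
      (Real.continuous_sin.comp (continuous_const.sub continuous_id))
  have hfsmooth : ContDiff ℝ (⊤ : ℕ∞) f :=
    (hχ.comp (contDiff_id.sub contDiff_const)).mul
      (Real.contDiff_sin.comp (contDiff_const.sub contDiff_id))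
  have hfsupp : HasCompactSupport f := HasCompactSupport.intro isCompact_Icc hfK
  have hfint : Integrable f := hfcont.integrable_of_hasCompactSupport hfsupp
  have hfabs : ∀ u, |f u| ≤ 1 := fun u ↦ by
    rw [hf, abs_mul]
    exact mul_le_one₀ (by rw [abs_of_nonneg (hχ0 _)]; exact hχ1 _) (abs_nonneg _)
      (Real.abs_sin_le_one _)
  refine ⟨f, hfsmooth, hfsupp, ?_, ?_, ?_, ?_⟩
  · -- support in `[c - R' - 1, c + R' + 1] ⊆ (0, ∞)`
    have h1 : tsupport f ⊆ Icc (c - (R' + 1)) (c + (R' + 1)) :=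
      closure_minimal (fun u hu ↦ by by_contra h; exact hu (hfK u h)) isClosed_Icc
    exact h1.trans fun u hu ↦ mem_Ici.2 (by linarith [hu.1])
  · -- `A = ∫ f(u) cos(a-u) du = 0` by oddness about `c`
    have hcomp : ∀ u, u ∉ Ioi (0 : ℝ) → f u * Real.cos (a - u) = 0 := fun u hu ↦ by
      rw [hfK u fun h ↦ hu (mem_Ioi.2 (by linarith [h.1])), zero_mul]
    rw [setIntegral_eq_integral_of_forall_compl_eq_zero hcomp,
      ← integral_add_left_eq_self (fun u ↦ f u * Real.cos (a - u)) c]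
    have hodd : ∀ v, f (c + -v) * Real.cos (a - (c + -v)) = -(f (c + v) * Real.cos (a - (c + v))) := by
      intro v
      have h1 : a - (c + -v) = v - m * (2 * Real.pi) := by rw [hc]; ring
      have h2 : a - (c + v) = -v - m * (2 * Real.pi) := by rw [hc]; ring
      simp only [hf, add_sub_cancel_left, h1, h2, Real.sin_sub_nat_mul_two_pi,
        Real.cos_sub_nat_mul_two_pi, Real.sin_neg, Real.cos_neg, hχev v]
      ring
    have hneg := integral_neg_eq_self (fun v ↦ f (c + v) * Real.cos (a - (c + v))) volume
    simp only [hodd, integral_neg] at hneg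
    linarith
  · -- `B = ∫ f(u) sin(a-u) du ≥ ∫_{[c-R', c+R']} sin²(a-u) du ≥ R' - 1`
    have hle : c - R' ≤ c + R' := by linarith
    have hplateau : ∀ u ∈ Icc (c - R') (c + R'), f u * Real.sin (a - u) = Real.sin (a - u) ^ 2 := by
      intro u hu
      have : χ (u - c) = 1 := hχone _ (by rw [abs_le]; constructor <;> linarith [hu.1, hu.2])
      simp [hf, this, sq]
    calc R' - 1 ≤ (Real.sin (a - (c + R')) * Real.cos (a - (c + R')) -
          Real.sin (a - (c - R')) * Real.cos (a - (c - R')) + (a - (c - R')) - (a - (c + R'))) / 2 := by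
          nlinarith [sq_nonneg (Real.sin (a - (c + R')) + Real.cos (a - (c + R'))),
            sq_nonneg (Real.sin (a - (c - R')) - Real.cos (a - (c - R'))),
            Real.sin_sq_add_cos_sq (a - (c + R')), Real.sin_sq_add_cos_sq (a - (c - R'))]
      _ = ∫ x in (a - (c + R'))..(a - (c - R')), Real.sin x ^ 2 := integral_sin_sq.symm
      _ = ∫ u in (c - R')..(c + R'), Real.sin (a - u) ^ 2 :=
          (intervalIntegral.integral_comp_sub_left (fun y ↦ Real.sin y ^ 2) a).symm
      _ = ∫ u in Icc (c - R') (c + R'), f u * Real.sin (a - u) := by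
          rw [intervalIntegral.integral_of_le hle, ← integral_Icc_eq_integral_Ioc,
            setIntegral_congr_fun measurableSet_Icc hplateau]
      _ ≤ ∫ u in Ioi (0 : ℝ), f u * Real.sin (a - u) := by
          apply setIntegral_mono_set
          · exact ((hfcont.mul (Real.continuous_sin.comp
              (continuous_const.sub continuous_id))).integrable_of_hasCompactSupport
              hfsupp.mul_right).integrableOn
          · refine Filter.Eventually.of_forall fun u ↦ ?_
            have : f u * Real.sin (a - u) = χ (u - c) * Real.sin (a - u) ^ 2 := by
              simp only [hf]; ring
            show (0 : ℝ) ≤ f u * Real.sin (a - u)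
            rw [this]
            exact mul_nonneg (hχ0 _) (sq_nonneg _)
          · refine Filter.Eventually.of_forall fun u hu ↦ ?_
            have h1 : c - R' ≤ u := (mem_Icc.1 hu).1
            have h2 : (0 : ℝ) < u := by linarith
            exact h2
  · -- `∫ f² ≤ 2(R' + 1)`
    have hK : Icc (c - (R' + 1)) (c + (R' + 1)) ⊆ Ioi 0 := fun u hu ↦ mem_Ioi.2 (by linarith [hu.1])
    rw [setIntegral_eq_of_subset_of_forall_sdiff_eq_zero measurableSet_Ioi hK
      (fun u hu ↦ by rw [hfK u hu.2]; ring)]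
    calc ∫ u in Icc (c - (R' + 1)) (c + (R' + 1)), f u ^ 2
        ≤ ∫ u in Icc (c - (R' + 1)) (c + (R' + 1)), (1 : ℝ) := by
          refine setIntegral_mono ((hfcont.pow 2).continuousOn.integrableOn_compact isCompact_Icc)
            (continuous_const.continuousOn.integrableOn_compact isCompact_Icc) fun u ↦ ?_
          show f u ^ 2 ≤ 1
          rw [← sq_abs]
          exact pow_le_one₀ (abs_nonneg _) (hfabs u)
      _ = 2 * (R' + 1) := by
          rw [setIntegral_const, smul_eq_mul, mul_one, Real.volume_real_Icc_of_le (by linarith)]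
          ring


/-- Bookkeeping for the top layer `T = {1/2 + i}` on the line: the stub's gain expression is
`(∫ f cos(a-·))² - (∫ f sin(a-·))²`. [folklore] -/
theorem re_phase_sq_laplace {f : ℝ → ℝ} (hf : Continuous f) (hfc : HasCompactSupport f) (a : ℝ) :
    (cexp (2 * (((1 / 2 : ℂ) + I).im : ℂ) * (a : ℂ) * I) *
        (∫ u in Set.Ioi (0 : ℝ), (f u : ℂ) * cexp (-(((1 / 2 : ℂ) + I - 1 / 2) * (u : ℂ)))) ^ 2).re =
      (∫ u in Set.Ioi (0 : ℝ), f u * Real.cos (a - u)) ^ 2 -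
        (∫ u in Set.Ioi (0 : ℝ), f u * Real.sin (a - u)) ^ 2 := by
  have him : ((1 / 2 : ℂ) + I).im = 1 := by simp
  have hsub : (1 / 2 : ℂ) + I - 1 / 2 = I := by ring
  simp only [him, hsub, Complex.ofReal_one, mul_one]
  -- the phase-shifted Laplace transform `W = e^{ia} ∫ f e^{-iu} = ∫ f(u) e^{i(a-u)}`
  set g : ℝ → ℂ := fun u ↦ (f u : ℂ) * cexp (((a - u : ℝ) : ℂ) * I) with hg
  have hgcont : Continuous g :=
    (continuous_ofReal.comp hf).mul (Complex.continuous_exp.comp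
      ((continuous_ofReal.comp (continuous_const.sub continuous_id)).mul continuous_const))
  have hgsupp : HasCompactSupport g := by
    refine hfc.comp_left (g := fun x : ℝ ↦ (x : ℂ)) Complex.ofReal_zero |>.mul_right
  have hgint : Integrable g (volume.restrict (Ioi 0)) :=
    (hgcont.integrable_of_hasCompactSupport hgsupp).integrableOn
  have hW : cexp ((a : ℂ) * I) * ∫ u in Set.Ioi (0 : ℝ), (f u : ℂ) * cexp (-(I * (u : ℂ))) =
      ∫ u in Set.Ioi (0 : ℝ), g u := by
    rw [← integral_const_mul]
    refine setIntegral_congr_fun measurableSet_Ioi fun u _ ↦ ?_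
    rw [hg, mul_left_comm, ← Complex.exp_add]
    congr 1
    push_cast
    ring
  have h2 : cexp (2 * (a : ℂ) * I) = cexp ((a : ℂ) * I) ^ 2 := by
    rw [sq, ← Complex.exp_add]; congr 1; ring
  have hre : (∫ u in Set.Ioi (0 : ℝ), g u).re = ∫ u in Set.Ioi (0 : ℝ), f u * Real.cos (a - u) := by
    have := integral_re hgint
    simp only [RCLike.re_to_complex] at this
    rw [← this]
    refine setIntegral_congr_fun measurableSet_Ioi fun u _ ↦ ?_
    simp only [hg, Complex.re_ofReal_mul, Complex.exp_ofReal_mul_I_re]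
  have him' : (∫ u in Set.Ioi (0 : ℝ), g u).im = ∫ u in Set.Ioi (0 : ℝ), f u * Real.sin (a - u) := by
    have := integral_im hgint
    simp only [RCLike.im_to_complex] at this
    rw [← this]
    refine setIntegral_congr_fun measurableSet_Ioi fun u _ ↦ ?_
    simp only [hg, Complex.im_ofReal_mul, Complex.exp_ofReal_mul_I_im]
  rw [h2, ← mul_pow, hW, sq, Complex.mul_re, hre, him']
  ring

/-- **`0 < η₀` is load-bearing in TORUS (`stub_torusTopHeavy`)**: with `0 < η₀` weakened to
`0 ≤ η₀` the statement is FALSE — witness `η₀ = 0`, `T = {1/2 + i}`, `w = 1`: by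
`exists_resonant_profile` the danger `(∫ f sin(a-·))² - (∫ f cos(a-·))²` exceeds `D ∫ f²` for
every `D`, so the danger clause fails for all `δ`, `a`, `D`. [folklore] -/
theorem stubTorusTopHeavy_false_without_etaPos :
    ¬ ∀ η₀ : ℝ, 0 ≤ η₀ → ∀ T : Finset ℂ, T.Nonempty → (∀ ρ ∈ T, ρ.re = 1 / 2 + η₀) →
      ∀ w : ℂ → ℝ, (∀ ρ ∈ T, 0 < w ρ) →
      ∃ δ : ℝ, 0 < δ ∧ ∃ a : ℝ, ∃ D : ℝ, 0 ≤ D ∧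
        (∀ f : ℝ → ℝ, ContDiff ℝ (⊤ : ℕ∞) f → HasCompactSupport f → tsupport f ⊆ Set.Ici 0 →
          -(∑ ρ ∈ T, w ρ * (Complex.exp (2 * (ρ.im : ℂ) * (a : ℂ) * Complex.I) *
              (∫ u in Set.Ioi (0 : ℝ), (f u : ℂ) * Complex.exp (-((ρ - 1 / 2) * (u : ℂ)))) ^ 2).re)
            ≤ D * ∫ u in Set.Ioi (0 : ℝ), f u ^ 2) ∧
        (∃ f : ℝ → ℝ, ContDiff ℝ (⊤ : ℕ∞) f ∧ HasCompactSupport f ∧ tsupport f ⊆ Set.Ici 0 ∧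
          0 < ∫ u in Set.Ioi (0 : ℝ), f u ^ 2 ∧
          (D + δ) * ∫ u in Set.Ioi (0 : ℝ), f u ^ 2 ≤
            ∑ ρ ∈ T, w ρ * (Complex.exp (2 * (ρ.im : ℂ) * (a : ℂ) * Complex.I) *
              (∫ u in Set.Ioi (0 : ℝ), (f u : ℂ) * Complex.exp (-((ρ - 1 / 2) * (u : ℂ)))) ^ 2).re) := by
  intro h
  obtain ⟨δ, hδ, a, D, hD, hdanger, -⟩ :=
    h 0 le_rfl {(1 / 2 : ℂ) + I} (Finset.singleton_nonempty _)
      (fun ρ hρ ↦ by rw [Finset.mem_singleton.1 hρ]; simp) (fun _ ↦ 1) (fun _ _ ↦ one_pos)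
  obtain ⟨f, hf, hfc, hfs, hA, hB, hN⟩ := exists_resonant_profile a (2 * D + 3) (by linarith)
  have hd := hdanger f hf hfc hfs
  simp only [Finset.sum_singleton, one_mul] at hd
  rw [re_phase_sq_laplace hf.continuous hfc a, hA] at hd
  nlinarith [hd, hB, hN, hD]

/-- VERBATIM statement of stub **LOC** `stub_finiteDefectLocalisation`. -/
def StubLoc : Prop :=
    ∀ hS : ({ρ : ℂ | riemannZeta ρ = 0 ∧ 0 < ρ.re ∧ ρ.re < 1 ∧ ρ.re ≠ 1 / 2}).Finite,
      ∀ η₀ : ℝ, 0 < η₀ →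
      (∀ ρ : ℂ, riemannZeta ρ = 0 → 0 < ρ.re → ρ.re < 1 → ρ.re ≠ 1 / 2 → |ρ.re - 1 / 2| ≤ η₀) →
      ∀ T : Finset ℂ, (∀ ρ : ℂ, ρ ∈ T ↔ (riemannZeta ρ = 0 ∧ ρ.re = 1 / 2 + η₀)) → T.Nonempty →
      ∀ δ : ℝ, 0 < δ → ∀ f₀ : ℝ → ℝ, ContDiff ℝ (⊤ : ℕ∞) f₀ → HasCompactSupport f₀ →
      tsupport f₀ ⊆ Set.Ici 0 → 0 < ∫ u in Set.Ioi (0 : ℝ), f₀ u ^ 2 →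
      (∃ᶠ a : ℝ in Filter.atTop, ∃ D : ℝ, 0 ≤ D ∧
        (∀ f : ℝ → ℝ, ContDiff ℝ (⊤ : ℕ∞) f → HasCompactSupport f → tsupport f ⊆ Set.Ici 0 →
          -(∑ ρ ∈ T, (riemannZetaZeroOrder ρ : ℝ) *
              (Complex.exp (2 * (ρ.im : ℂ) * (a : ℂ) * Complex.I) *
              (∫ u in Set.Ioi (0 : ℝ), (f u : ℂ) * Complex.exp (-((ρ - 1 / 2) * (u : ℂ)))) ^ 2).re)
            ≤ D * ∫ u in Set.Ioi (0 : ℝ), f u ^ 2) ∧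
        (D + δ) * ∫ u in Set.Ioi (0 : ℝ), f₀ u ^ 2 ≤
          ∑ ρ ∈ T, (riemannZetaZeroOrder ρ : ℝ) *
            (Complex.exp (2 * (ρ.im : ℂ) * (a : ℂ) * Complex.I) *
            (∫ u in Set.Ioi (0 : ℝ), (f₀ u : ℂ) * Complex.exp (-((ρ - 1 / 2) * (u : ℂ)))) ^ 2).re) →
      ∃ a : ℝ, 0 < a ∧ ∃ o : ℝ → ℂ, IsWeilTest o ∧ tsupport o ⊆ Set.Icc (-a) a ∧
        (∀ t, o (-t) = -o t) ∧ ∫ t, ‖o t‖ ^ 2 = (1 : ℝ) ∧ ∃ m : ℝ, 0 < m ∧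
        ∀ e : ℝ → ℂ, IsWeilTest e → tsupport e ⊆ Set.Icc (-a) a → (∀ t, e (-t) = e t) →
          (∀ t, (e t).im = 0) → ∫ t, ‖e t‖ ^ 2 = (1 : ℝ) →
          (weilQuadratic o).re + m ≤ (weilQuadratic e).re

/-- **LOC is immune**: its hypotheses (`T.Nonempty` with `T = {ζ = 0, Re = 1/2 + η₀}`, `η₀ > 0`)
already exhibit an off-line zero, so LOC holds vacuously under RH and any refutation of LOC
disproves RH. -/
theorem stubLoc_immune (h : ¬ StubLoc) : ¬ RiemannHypothesis := by
  intro hRH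
  apply h
  intro hS η₀ hη₀ hbd T hT hTne
  exfalso
  obtain ⟨ρ, hρ⟩ := hTne
  obtain ⟨hz, hre⟩ := (hT ρ).1 hρ
  exact not_exists_isOffLineZero_of_riemannHypothesis hRH
    ⟨ρ, hz, by linarith, re_lt_one_of_riemannZeta_eq_zero hz, by linarith⟩

/-- VERBATIM statement of stub **INF** `stub_infiniteDefectDetection`. -/
def StubInf : Prop :=
    ({ρ : ℂ | riemannZeta ρ = 0 ∧ 0 < ρ.re ∧ ρ.re < 1 ∧ ρ.re ≠ 1 / 2}).Infinite →
      ∃ a : ℝ, 0 < a ∧ ∃ x : ℝ, weilOddGroundEnergy a < x ∧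
        ∀ e : ℝ → ℂ, IsWeilTest e → tsupport e ⊆ Set.Icc (-a) a → (∀ t, e (-t) = e t) →
          (∀ t, (e t).im = 0) → ∫ t, ‖e t‖ ^ 2 = (1 : ℝ) → x ≤ (weilQuadratic e).re

/-- **INF is immune**: a refutation needs the off-line set to be infinite, in particular nonempty,
hence disproves RH.  WHY IT RESISTS EVEN AS A MECHANISM (adversarial configuration, this seat):
offsets `η_k = η*(1 − 1/√k) ↑ η*` (unattained), heights `γ_k = exp(exp(k²))`.  Zero `k` becomes
VISIBLE (its gain `≍ e^{2η_k a}` beats its own on-line penalty `≍ log γ_k`) at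
`a_k ≍ (log log γ_k)/(2η_k) ≍ k²/(2η*)`, dominates the floors of BOTH sectors on `[a_k, a_{k+1})`
(takeover ratio `e^{2(η_k − η_{k−1}) a} ≥ e^{c√k}`), but its parity SPLITTING
`≍ e^{2η_k a}/γ_k` emerges above the on-line interference only at `b_k ≍ (log γ_k)/(2η_k) ≍
e^{k²}/(2η*) ≫ a_{k+1}`.  So at NO window does any off-line splitting decide the order; on
`[a_k, a_{k+1})` the order is decided by the on-line interference
`I_k(a) = Re Σ_γ m(½+iγ) e^{2iγa} F_k(iγ)²` of the floor-optimal profiles — a mean-zero almost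
periodic function of `a` (absolutely convergent), which changes sign (Bohr).  Consequences:
(i) no counter-configuration is obtained this way either (odd still wins on about half of every
`[a_k, a_{k+1})`); (ii) any PROOF of INF must keep the on-line terms in the even-floor lower bound
(the landed EVEN-LOW "drop the on-line terms" bound is `−∞` here: `Σ_k e^{2η_k a}/(8η_k)`
diverges) and must extract a sign change from an on-line zero sum at height `≍ γ_{k(a)}` — a
Landau/Bohr statement about `ζ`'s critical zeros near astronomically large ordinates, in the
presence of the hypothetical off-line zeros.  This sharpens the planner's "no Landau lemma for an
inf-functional" to a concrete regime. -/
theorem stubInf_immune (h : ¬ StubInf) : ¬ RiemannHypothesis := by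
  intro hRH
  apply h
  intro hinf
  exfalso
  obtain ⟨ρ, hζ, h0, h1, hne⟩ := hinf.nonempty
  exact not_exists_isOffLineZero_of_riemannHypothesis hRH ⟨ρ, hζ, h0, h1, hne⟩

end Summit.RiemannHypothesis.RiemannHypothesis.Cruxes.OffLineParityDetection.Disproof

end
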